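import Mathlib
import HarnessLib
import HarnessLib.Audit
import Summits.CriticalPhenomena.Statement
import HarnessLib.Audit.Status.Attr

/-!
Route: BernsteinTemperature

DORMANT since 2026-08-24T20:49:26Z (reconciler: no traction for 7.1 d (last activity item-evidence-added at 2026-08-17T18:45:47Z); parked, not closed — `ledger route dormant route-CriticalPhenomena-BernsteinTemperature --off` to reactiv) — unstaffed, not closed; items shared with open routes are served there. `ledger route dormant <id> --off` reactivates.

# Route BernsteinTemperature — Ising correlations absolutely monotone in tanh beta up to beta_c +
isotropic local limit of the positive HT kernels => isotropic pure power law at beta_c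

It suffices to show X = (AM) ∧ (KLL), realising card absolute-monotonicity-in-temperature (spine;
its items N1, N3, with N2/N4 as
support). (AM) = AbsMonotoneTanh: for every x ∈ ℤ³ the plus-state two-point function β ↦ ⟨σ₀σ_x⟩⁺_β
of the n.n. Ising model is, on
[0, β_c(3)), a convergent power series in v = tanh β with NON-NEGATIVE coefficients a_n(x) supported
on n ≥ |x|₁, n ≡ |x|₁ (mod 2)
(Bernstein: v ↦ ⟨σ₀σ_x⟩ is absolutely monotone on [0, v_c), v_c = tanh β_c(3); true on trees and on
ℤ, empirical on ℤ³). (KLL) =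
KernelLocalLimit: the HT displacement kernels q_n(x) = a_n(x)/Σ_y a_n(y) — probability kernels once
(AM) holds — have an ISOTROPIC
local limit n^{3ν} q_n(x) → 2Q(|x|₂/n^ν) with polynomial tails, and the susceptibility coefficients
s_n = v_cⁿ Σ_y a_n(y) are regularly
varying with a pure power, s_n n^{1−γ} → C > 0, γ < 3ν. Since ⟨σ₀σ_x⟩_{β_c} = Σ_n s_n q_n(x) exactly
(monotone convergence at the edge of
the Bernstein cone: no UV crossover), an Abelian summation gives ⟨σ₀σ_x⟩_{β_c}·|x|₂^{2Δ} → c > 0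
with 2Δ = 3 − γ/ν (Fisher's relation
falls out): the rotation-invariant pure power law, item 0634 of IsingEuclidUpgrade, which the shared
two-point-spine complement
(MoebiusLimitOfTwoPointLaw, item 4801) and U₄ ≢ 0 (item 0636) carry to the conjunct. Off the spine,
(AM) alone gives the
three-temperature inequality ⟨σ₀σ_x⟩_β tanh^{|x|₁}β' ≤ ⟨σ₀σ_x⟩_{β'} tanh^{|x|₁}β (β ≤ β' ≤ β_c):
explicit mass m(β) ≥ log(v_c/tanh β), ν ≤ 1.
Lean: `AbsMonotoneTanh ∧ KernelLocalLimit` (the two decls below, over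
Literature.Probability.LatticeModels.{Site, twoPointPlus, criticalBeta, criticalTwoPoint,
HasIsingExponentNu, CorrFamily, HasPointwiseScalingLimit, criticalCorr, IsNondegenerateTwoPoint,
IsMoebiusCovariant, HasNontrivialU4}, Real.tanh, Real.sqrt, HasSum, Summable, Filter.Tendsto,
ContinuousOn, Even, Int.natAbs — all `lean search --decl`-verified; PlanarPressureAM writes
Onsager's ψ(β) and β_c(2) = log(1+√2)/2 out over Mathlib (rev 3 route-repair: no Literature import
beyond the Statement, used-constants cone clean); Sketch.lean elaborates rc 0 and proves the
Assembly term sorry-free, axioms propext/Classical.choice/Quot.sound)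

## Assembly
Pure logic, proved sorry-free in the planner's Sketch.lean (`assembly_proof`, axioms
propext/Classical.choice/Quot.sound): KernelTransfer
applied to AbsMonotoneTanh and KernelLocalLimit gives the isotropic pure power law (item 0634);
MoebiusLimitOfTwoPointLaw turns it into
ρ, Δ, S with ρ > 0 on (0,1], Δ > 0, HasPointwiseScalingLimit (criticalCorr 3) ρ S,
IsNondegenerateTwoPoint S, IsMoebiusCovariant Δ S;
IsingEuclidUpgradeR4NonGaussian applied to (ρ, S) gives HasNontrivialU4 S; these are the six fields
of CritIsing3DConformalLimit =
Ising3DConformalLimit. ThreeTemperature, MassFromAM, NuLeOne, PlanarPressureAM are off the chain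
(independent value: explicit mass, ν ≤ 1,
the solvable rung).

Rationale: WHY THIS LINE. Every route in hand approaches clause (ii) in the SCALE or SPACE variable at β_c
(HyperoctahedralRP: nine-mirror RP; PrecisionLaplacian,
InverseSquareTelemetry: the precision operator; TauBallRounding: the subcritical norm τ_β with an
unproved UV crossover). This line uses the
EXPANSION-ORDER variable: the sign of ALL tanh β–Taylor coefficients of ⟨σ₀σ_x⟩ at β = 0 (folklore
positivity of HT series,
OitmaaHamerZheng2006 §2.3, SykesEtAl1972, FisherBurford1967, Guttmann1987; 'positive coefficients ⇒
the critical point is the radius',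
LavisBell1999 §7.5) made into the conjecture that β_c is the edge of a Bernstein–Widder cone, the
ferromagnetic mirror image of the
Groeneveld–Penrose alternating-sign theorem for repulsive gases (Penrose1963). What is imported:
classical function theory of absolutely
monotone functions / power series with non-negative coefficients (Bernstein, Vivanti–Pringsheim) and
Abelian summation with a local limit
theorem (probability: the kernels q_n are laws of the endpoint of an order-n HT cluster); the exact
identity G_{β_c} = Σ_n s_n q_n replaces
the UV-crossover bet of TauBallRounding, and isotropy is pushed onto fixed-order
lattice-combinatorial objects, where cubic symmetry plus a
local limit is the natural home of rotation invariance. GKS gives only the first β-derivative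
(FriedliVelenik2017 §3.6), Shlosman1986 signs
Ursell functions not β-derivatives, Ott2019 gives real analyticity of the pressure below β_c but no
disk and no signs, sharpness
(AizenmanBarskyFernandez1987, DuminilCopinTassionCMP2016) gives m(β) > 0 without a rate: none yields
(AM), the three-temperature
inequality, ν ≤ 1, or the positive-kernel representation of the critical two-point function; the
negatives index (stmt-0772, SAW) is not touched.

RANKED CRUXES. #2 AbsMonotoneTanh (crux) — (AM-v)₃, card item N1, robust form: for every x ∈ ℤ³
there are coefficients a_n ≥ 0, vanishing for n < |x|₁ and for n ≢ |x|₁ (mod 2), with ⟨σ₀σ_x⟩⁺_β =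
Σ_n a_n tanhⁿβ (convergent) for all 0 ≤ β < β_c(3). Equivalently tanh β ↦ ⟨σ₀σ_x⟩ is absolutely
monotone on [0, v_c): all HT coefficients are ≥ 0 AND no complex singularity of the infinite-volume
correlation lies in |v| < v_c. k = 1 is GKS; true on trees/ℤ (⟨σ₀σ_x⟩ = v^{|x|}); finite-volume
correlations are never AM to all orders (Fisher-zero pairs), so this is a thermodynamic-limit
statement. [difficulty: open-problem] (why it might fail: A signed vacuum correction of the
linked-cluster expansion could make some [vⁿ]⟨σ₀σ_x⟩ negative at an order n ≫ |x|₁ beyond the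
published tables, or an infinite-volume complex Fisher singularity of some G_x could sit inside |v|
< v_c = 0.2181; positivity is only empirical (orders ≤ 25).) [OitmaaHamerZheng2006, SykesEtAl1972,
FisherBurford1967, Guttmann1987, ButeraComi2002, LavisBell1999, Penrose1963, Ott2019,
PetersRegts2019]
#3 KernelLocalLimit (crux) — card item N3 made precise: for every non-negative coefficient family a
: ℤ³ × ℕ → ℝ representing the two-point functions as in AbsMonotoneTanh, there are ν > 0, γ < 3ν, C,
A > 0, p > 3 − γ/ν and a continuous profile Q ≥ 0 on [0,∞), positive somewhere, with: Σ_y a_n(y) <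
∞; regular variation with a pure power of the susceptibility coefficients, tanhⁿβ_c · Σ_y a_n(y) /
n^{γ−1} → C; the isotropic local limit sup_{|x|₂ ≤ R n^ν, n ≡ |x|₁ (2)} |n^{3ν} a_n(x)/(2Σ_y a_n(y))
− Q(|x|₂/n^ν)| → 0 for every R; and the tail bound n^{3ν} a_n(x)/Σ_y a_n(y) ≤ A (1 + |x|₂/n^ν)^{−p}.
(Scaling theory: Q(r) ~ r^{(γ−1)/ν} at 0, stretched-exponential tails; Q radial = isotropy of the
near-critical scaling function organised by expansion order.) [deps: AbsMonotoneTanh] [difficulty: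
open-problem] (why it might fail: q_n is a ratio of signed cluster sums with no sampler unless
(AM)'s involution exists; fixed-order HT clusters keep cubic anisotropy decaying only like n^{−ων}
(ω≈0.8) and pure-power regular variation of s_n (no log / confluent drift in the limit) is itself
open in d = 3.) [FisherBurford1967, Guttmann1987, ButeraComi2002, CampostriniEtAl1998,
DuminilCopinICM2022, Fisher1967]
#4 ThreeTemperature (crux) — card consequence (C1), the teeth, filed as its own refutable statement
(weaker than AbsMonotoneTanh, implied by it via MassFromAM): for all x ∈ ℤ³ and 0 ≤ β ≤ β' ≤ β_c(3),
⟨σ₀σ_x⟩⁺_β · tanh^{|x|₁}β' ≤ ⟨σ₀σ_x⟩⁺_{β'} · tanh^{|x|₁}β, i.e. β ↦ ⟨σ₀σ_x⟩_β / tanh^{|x|₁}β is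
non-decreasing up to AND including β_c (saturated on trees). At β' = β_c: ⟨σ₀σ_x⟩_β ≤ (tanh β/tanh
β_c)^{|x|₁}⟨σ₀σ_x⟩_{β_c} — sharpness with the explicit mass m(β) ≥ log(tanh β_c/tanh β) ≥ c(β_c −
β), hence ν ≤ 1 (NuLeOne); no rigorous upper bound on ν(3) was found in the searched literature.
[difficulty: L] (why it might fail: Asymptotically in |x| it says the loop-entropy gain s_β(u) =
|u|₁log(1/tanh β) − τ_β(u) never exceeds its critical value in any direction u; only β→0 asymptotics
(tight to leading order) and scaling estimates (margins ×2–×10 for β ≥ 0.1) support it.)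
[AizenmanBarskyFernandez1987, DuminilCopinTassionCMP2016, Simon1980, CampostriniEtAl1998,
MessagerMiracleSoleJSP1977, Schrader1976]
#5 MoebiusLimitOfTwoPointLaw (crux) — IMPORTED COMPLEMENT (item stmt-CriticalPhenomena-4801 of
PrecisionLaplacian, verbatim; lowest own rank; this route does not attack it): if the critical
two-point function on ℤ³ is asymptotically an isotropic pure power law (item 0634 as hypothesis),
then the critical correlators have a non-degenerate pointwise scaling limit (ρ > 0 on (0,1], Δ > 0,
S) that is Möbius covariant — the conjunct minus clause (iii). The two-point law supplies ρ(δ) =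
δ^{−Δ}, non-degeneracy and Möbius covariance of S₂; n ≥ 4 existence, O(3) for n ≥ 3 and inversion
covariance remain (bets: HyperoctahedralRP 1980–1982, IsingEuclidUpgrade 0637/0638). [difficulty:
open-problem] (why it might fail: Given the two-point law, full δ→0⁺ convergence for n ≥ 4, O(3)
invariance of S_n and inversion covariance stay open on ℤ³ (ICM 2022 §8.4); Euclid+scale ⇏ Möbius in
general (ScaleCovarianceNotMoebius), no planar engine transposes (LiouvilleRigidity).)
[DuminilCopinICM2022, PolandRychkovVichi2019,
Literature.Barriers.CriticalPhenomena.ScaleCovarianceNotMoebius,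
Literature.Barriers.CriticalPhenomena.LiouvilleRigidity, stmt-CriticalPhenomena-0634,
stmt-CriticalPhenomena-1344]
#6 IsingEuclidUpgradeR4NonGaussian (crux) — SHARED (item stmt-CriticalPhenomena-0636, verbatim):
every non-degenerate pointwise scaling limit S of the renormalised critical Ising correlators on ℤ³
has connected four-point function U₄ ≢ 0 on non-coincident configurations (random-current
intersection identity; its negation refutes the conjunct itself). Not attacked by this route.
[difficulty: open-problem] (why it might fail: No proof that U₄ ≢ 0 in d = 3: the double-current
intersection probability at macroscopic separation must stay > 0 as δ → 0; RP long-range models ON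
ℤ³ (α < 3/2) are Gaussian (LongRangeTrivialityOnZ3).) [AizenmanDuminilCopinAnnals2021,
AizenmanCMP1982, DuminilCopinICM2022,
Literature.Barriers.CriticalPhenomena.IsingTrivialityFromDimensionFour,
Literature.Barriers.CriticalPhenomena.LongRangeTrivialityOnZ3]
#9 KernelTransfer (support) — glue (Abelian summation, real analysis; card (C5)): AbsMonotoneTanh →
KernelLocalLimit → IsingEuclidUpgradeR2RotInvPowerLaw. Proof sketch: from (AM), monotone convergence
and the tree facts plusCorr_mono_params, left-continuity of the free state in β (sup of box limits),
twoPointFree_le_twoPointPlus_holds and twoPointPlus_criticalBeta_eq_twoPointFree_holds,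
⟨σ₀σ_x⟩_{β_c} = Σ_n a_n(x) v_cⁿ = Σ_n s_n q_n(x) (finite, ≤ 1); parity halves the n-sum against the
factor 2; the local limit with the integrable majorant A s_n n^{−3ν}(1+|x|/n^ν)^{−p} (p > 3 − γ/ν, γ
< 3ν) turns Σ_n into C|x|^{−(3−γ/ν)} ∫₀^∞ u^{γ−1−3ν} Q(u^{−ν}) du · (1+o(1)) by dominated
convergence after n = |x|^{1/ν}u; so 2Δ = 3 − γ/ν and c > 0. [difficulty: M] [Fisher1967,
FriedliVelenik2017,
Literature.Probability.LatticeModels.twoPointPlus_criticalBeta_eq_twoPointFree_holds,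
Literature.Probability.LatticeModels.plusCorr_mono_params]
#9 MassFromAM (support) — glue, provable now (card N2 = (AM) ⇒ (C1)): AbsMonotoneTanh →
ThreeTemperature. For β ≤ β' < β_c: ⟨σ₀σ_x⟩_β = v^L Σ_{n≥L} a_n v^{n−L} with L = |x|₁ and the second
factor non-decreasing in v = tanh β; for β' = β_c use ⟨σ₀σ_x⟩_{β''} ≤ ⟨σ₀σ_x⟩⁺_{β_c}
(plusCorr_mono_params) for β'' < β_c and let β'' ↑ β_c in tanh (continuity); x = 0 and β = 0 are
trivial (twoPointPlus_zero, 0^L). [difficulty: provable-now] [FriedliVelenik2017,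
Literature.Probability.LatticeModels.plusCorr_mono_params,
Literature.Probability.LatticeModels.twoPointPlus_zero]
#9 NuLeOne (support) — provable now (card (C1) ⇒ ν ≤ 1): ThreeTemperature → every correlation-length
exponent ν of the ℤ³ Ising model (HasIsingExponentNu 3 ν: log ξ(β)/log(β_c − β) → −ν, ξ = axis
correlation length of the plus state) satisfies ν ≤ 1. Proof: ThreeTemperature at β' = β_c, x = n e₁
and ⟨σσ⟩ ≤ 1 give ⟨σ₀σ_{ne₁}⟩⁺_β ≤ (tanh β/tanh β_c)ⁿ, while ⟨σ₀σ_{ne₁}⟩⁺_β ≥ ⟨σ₀σ_{e₁}⟩ⁿ > 0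
(twoPointPlus_mul_le_twoPointPlus); so invCorrLength ≥ log(tanh β_c/tanh β) ≥ c(β_c − β) and ξ(β) ≤
C/(β_c − β) near β_c; divide logs (log(β_c − β) < 0). [difficulty: provable-now] [Fisher1967,
FriedliVelenik2017, Literature.Probability.LatticeModels.twoPointPlus_mul_le_twoPointPlus,
Literature.Probability.LatticeModels.twoPointPlus_le_one_of_nonneg]
#9 PlanarPressureAM (support) — the solvable rung (card N4, pressure form): Onsager's closed-form
pressure onsagerPressure β = log 2 + (8π²)⁻¹∬ log(cosh²2β − sinh 2β (cos θ₁ + cos θ₂)) is absolutely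
monotone in v = tanh β on [0, β_c(2)): ∃ a_n ≥ 0 with onsagerPressure β = Σ a_n tanhⁿβ for 0 ≤ β <
criticalBetaTwo = log(1+√2)/2. Evidence: ψ = log 2 − log(1 − v²) + (v⁴ + 2v⁶ + 9/2 v⁸ + 12v¹⁰ + …)
with all known polygon coefficients positive; the refuter's exact check of the energy u(v) to order
127 (all coefficients > 0) implies positivity of ψ's v-coefficients to order 128 (ψ' = 2u/(1−v²));
Darboux at the two singularities ±v_c ((1∓v/v_c)² log, coefficients 2/(m(m−1)(m−2)) > 0, even in v)
gives all large orders. A proof = finitely many exact orders + an explicit Darboux remainder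
(elliptic-integral AM techniques: YangTian2021). [difficulty: L] [Onsager1944, MccoyWu1973,
YangTian2021, OitmaaHamerZheng2006, LavisBell1999]
#9 IsingEuclidUpgradeR2RotInvPowerLaw (support) — SHARED MILESTONE (item stmt-CriticalPhenomena-0634
of IsingEuclidUpgrade, verbatim; the conclusion of KernelTransfer): the critical two-point function
of the n.n. Ising model on ℤ³ is asymptotically a rotation-invariant pure power law,
⟨σ₀σ_x⟩_{β_c(3)}·|x|₂^{2Δ} → c > 0 along the cofinite filter. On this route 2Δ = 3 − γ/ν comes out
of the kernel scaling (Fisher's relation). [difficulty: open-problem] [DuminilCopinICM2022,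
stmt-CriticalPhenomena-0634, Literature.Probability.LatticeModels.criticalTwoPoint_bounds_holds]

TWO-LAYER PLAN. Foreseen glued splits (nothing filed now; k ≤ 2, depth 1). AbsMonotoneTanh ⇐
PositiveHTCoefficients (∀ x n, the n-th tanh-Taylor
coefficient at 0 of the infinite-volume ⟨σ₀σ_x⟩ is ≥ 0 — the combinatorial core; hoped-for engine: a
sign-reversing involution on signed HT
clusters in the random-current multigraph representation, where an overlapping (sourced path, vacuum
loop) pair is again a legal current)
→ RealAnalyticBelowCritical (β ↦ ⟨σ₀σ_x⟩_β real-analytic on [0, β_c): Ott2019-type weak mixing for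
correlations; with a_n ≥ 0
Pringsheim then forces radius ≥ v_c) → AbsMonotoneTanh. KernelLocalLimit ⇐
SusceptibilityRegularVariation (s_n n^{1−γ} → C) →
KernelScalingGivenRV (local limit + tails) → KernelLocalLimit. ThreeTemperature ⇐ LDtSmallBeta
((LD-t) for β ≤ β₀ by convergent
expansion with remainder) → LDtBackbone (β₀ ≤ β < β_c via the exact backbone identity (C2):
E^{bb}[|ω|] − |x|₁ ≥ (sinh 2β/2)
E^{bb}[−∂_β log R_β(ω)]) → ThreeTemperature.

KILL CRITERIA. A certified negative tanh-coefficient of some ⟨σ₀σ_x⟩ on ℤ³ (Fisher–Burford /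
Guttmann tables, or a fresh linked-cluster computation), or
an infinite-volume complex singularity of some G_x inside |v| < v_c, refutes AbsMonotoneTanh; since
the kernels q_n then stop being
probability kernels, close `refuted:AbsMonotoneTanh` (ThreeTemperature keeps stand-alone value and
may be re-filed by another route as the
weak form (LD-t)). A Monte-Carlo / series violation of ThreeTemperature (some x, β < β' ≤ β_c with
⟨σ₀σ_x⟩_β tanh^{|x|₁}β' >
⟨σ₀σ_x⟩_{β'} tanh^{|x|₁}β) refutes AbsMonotoneTanh too (MassFromAM) — close. ¬KernelLocalLimit with
(AM) standing (e.g. a provably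
anisotropic kernel profile, or log-corrected s_n) forces a PIVOT, not a close: restate r3 as the
averaged/Tauberian form (regular variation
⇒ η and γ exist, Fisher relation) and hand isotropy back to the RP routes. Item 0634 proved
elsewhere (PrecisionLaplacian,
InverseSquareTelemetry) moots KernelLocalLimit/KernelTransfer for the summit but not
AbsMonotoneTanh/ThreeTemperature. Refutation of the
shared items 4801/0636 hits every two-point-spine route alike.

NOT DECOMPOSED YET. No target item (X is the conjunction of the rank-2 and rank-3 cruxes).
Deliberately not items at open: the involution engine and the
small-β rung of (AM) (layer-2 children above); (AM-β) (the bold β-variable form, loop-sensitive,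
false on trees) and (AM) for |A| > 2;
the moment inequalities (C3) Σ_x |x|₁^k⟨σ₀σ_x⟩_β ≤ (v∂_v)^k χ and ν_k ≤ 1; the disk-holomorphy
corollary (C4); the Hardy–Littlewood–Karamata
direction (γ exists ⇔ partial sums of s_n regularly varying); the planar two-point rung (⟨σ₀₀σ_NN⟩
via Toeplitz determinants) — only the
pressure rung is filed; left-continuity of the free state in β and plus = free below β_c are prover
lemmas (`--supports KernelTransfer`).

CHEAPEST FALSIFIER. (a) Table lookup: FisherBurford1967 (Phys. Rev. 156, Tables of ⟨σ₀σ_r⟩ HT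
coefficients on sc to order ~11) and Guttmann1987 (sc spin-spin
correlation series): ONE negative tanh-coefficient for the simple cubic lattice kills
AbsMonotoneTanh — not run here: both paywalled
(acq-02543 filed for Fisher–Burford). (b) Already run by the triage refuter on the card: exact v-
and β-coefficients of Onsager's n.n.
energy to order 127 — all positive (evidence for the planar rung; implies PlanarPressureAM to order
128). (c) Next cheapest: exact
v-coefficients of the planar diagonal correlations ⟨σ₀₀σ_NN⟩ (N ≤ 8, Toeplitz/Painlevé VI, orders ≤
80) and the linked-cluster
v-coefficients of ⟨σ₀σ_x⟩ on ℤ³ for |x|₁ ≤ 3 to order 15 (kit job, minutes); then worm-MC of β ↦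
⟨σ₀σ_x⟩_β/tanh^{|x|₁}β on (0, β_c) for
|x|₁ ≤ 10 (ThreeTemperature; predicted margin ≈ 4% at β ≈ 0.05, large near β_c).

NUMBERS. β_c(3) = 0.2216546(MC), v_c = tanh β_c(3) = 0.21809, 1/v_c = 4.585 (HT-cluster growth) vs
μ_SAW(ℤ³) = 4.684 vs 2d−1 = 5 and the Bethe
radius 1/(2d−1) = 0.2 < v_c (the annulus 0.2 < |v| < 0.218 is where lattice loops must act;
graph-uniform zero-freeness stops at the tree
threshold: PetersRegts2019, GalanisGoldbergHerrerapoyatos2022). Exponents (bootstrap/MC): γ =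
1.23708, ν = 0.62997, η = 0.03630, so
2Δ = 3 − γ/ν = 1.03630 = 1 + η (consistency of KernelLocalLimit with Fisher's relation), (γ−1)/ν =
0.3763 (Q(r) ~ r^{0.376} at 0),
γ − 1 − 3ν = −1.653, tail exponent needed p > 1.036. Explicit-mass bound ξ_axis(β) ≤ 1/log(v_c/tanh
β): 0.68 (β=0.05), 1.28 (0.10),
2.62 (0.15), 10.0 (0.20), 19.1 (0.21) against ξ ≈ 0.33, 0.44, 1.0, 2.2, 3.2 (HT leading order / ξ ≈
0.5 t^{−0.63}). Rigorous exponent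
inequalities known (Tasaki 1983 thesis §2; FriedliVelenik2017): γ ≥ 1, ν ≥ 1/2, 0 ≤ η ≤ 1, ν ≥
γ/(2−η); no rigorous UPPER bound on ν(3)
found — Schrader1976 is the renormalised-coupling inequality dν ≥ 2Δ₄ − γ (cited with the
Glimm–Jaffe bound in Brydges–Fröhlich–Sokal
1983 §1), not a ν bound. Planar: β_c(2) = 0.440687, v_c(2) = √2 − 1; sq pressure polygon series 1,
2, 9/2, 12, 37⅓, 130, …; refuter's
n.n.-energy v-coefficients 1, 2, 4, 12, 42, 164, 686, 3012, 13706 (all > 0 to order 127). sc: χ(v) =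
1 + 6v + 30v² + 150v³ + 726v⁴ +
3510v⁵ + 16710v⁶ + … (OitmaaHamerZheng2006 §2.3). Items at open: 11 (5 cruxes, 5 support, 1
assembly).

DEFINITION REQUESTS. None load-bearing: the ∃-coefficient formulation avoids `htCoeff` /
`IsAbsMonoOn`. Wanted later as Literature facts (not filed now):
Ott2019 (real analyticity of the pressure on (0, β_c), for the RealAnalyticBelowCritical child) and
a correlation-function version;
FisherBurford1967 tables as data (acq-02543).

Novelty: Searches (2026-08-15): `lit galaxy search "absolutely monotonic" --star all` (30 rows:
special-functions / bioassay / moment-problem books,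
none stat-mech); `lit galaxy search --star panama --mode bm25 "positivity of HT coefficients of
Ising correlations / sign pattern ⇒ dominant
singularity"` (12 textbooks: Yeomans, Cardy, OitmaaHamerZheng2006, Nishimori–Ortiz …, none stating a
theorem or conjecture);
`lit search --source crossref "absolutely monotonic function Ising model inverse temperature
correlation inequalities"` (15: YangTian2021
AM-with-elliptic-integrals, Guttmann1987 sc correlation series, Boel–Kasteleyn 1978, Graham 1982 —
no AM-in-β statement);
`lit search --source crossref "zero-free region partition function Ising complex temperature bounded
degree"` (PetersRegts2019,
GalanisGoldbergHerrerapoyatos2022, Brascamp–Kunz 1974); `lit search --source crossref "Schrader new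
rigorous inequality critical exponents"`
+ `lit read` of Brydges–Fröhlich–Sokal 1983 p.2 and Tasaki 1983 thesis pp.4,73,81 (what Schrader1976
is; the rigorous ν table);
`lit search --source zbmath` ×3 ("positivity high-temperature series coefficients Ising", "rigorous
bound correlation length exponent nu
Ising", "inequalities critical exponents correlation length Ising": 0/0/1 irrelevant); `lit search
--hybrid --source local "high-temperature
series coefficients positive susceptibility simple cubic"` (LavisBell1999 p.294: 'for a series of
positive coefficients … τ_c = R');
`lit vsearch "upper bound  [refs: OitmaaHamerZheng2006, YangTian2021, Guttmann1987, PetersRegts2019, GalanisGoldbergHerrerapoyatos2022, Schrader1976, LavisBell1999, SykesEtAl1972, Penrose1963, Ott2019, AizenmanBarskyFernandez1987, DuminilCopinTassionCMP2016, CampostriniEtAl1998]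

Barriers (technique_class: absolute-monotonicity-in-beta, positive-series-tauberian): - technique_class: absolute-monotonicity-in-beta, positive-series-tauberian
- Literature.Barriers.CriticalPhenomena.IsingTrivialityFromDimensionFour: not engaged by r2–r4 ((AM)
is dimension-uniform in form and claims nothing about U₄; presumably true in d ≥ 5 with ν = 1/2 ≤
1); it bears only on the shared item 0636, attacked elsewhere with d = 3 input.
- Literature.Barriers.CriticalPhenomena.LongRangeTrivialityOnZ3: evaded structurally — the
statements are nearest-neighbour-specific ((AM) fails already on trees and for the geodesic-free
long-range couplings the support clause n ≥ |x|₁ is meaningless); no interaction-uniform argument is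
proposed.
- Literature.Barriers.CriticalPhenomena.RigorousRGSmallParameter: no RG map and no small parameter
beyond analyticity at β = 0; the bet replacing it is a SIGN structure of all orders (an involution),
which is exact combinatorics, not a contraction estimate — it does not; the bet is that positivity
is provable order by order without controlling the flow.
- Literature.Barriers.CriticalPhenomena.PositionSpaceRGNonGibbsian: not engaged (no renormalised
measures).
- Literature.Barriers.CriticalPhenomena.LaceExpansionIsingAboveFour: not engaged — no expansion is
summed beyond its radius; convergence on [0, v_c) is the conjecture's content via positivity +
Pringsheim, not via diagrammatic bounds (which need d > 4).
- Literature.Barriers.CriticalPhenomena.ScaleCovarianceNotMoebius: bites only on the imported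
complement MoebiusLimitOfTwoPointL

Novelty grade: new-combination — route-review gen-2 (refuter 81300ae8-g2) NOVELTY new-combination = [AM-v conjecture: all tanh-Taylor coefficients of infinite-volume <s0sx> on Z^3 >= 0, radius v_c — folklore numerics (LavisBell1999 s7.5 'positive coefficients => critical point is the radius'; tables FisherBurford1967/SykesEtAl1972/ (refuter refuter-rreview-route-CriticalPhenomena--81300ae8-g2-0, 2026-08-15T14:57:42Z; prior: doi:10.1103/physrev.156.583 (FisherBurford1967), Penrose1963 (Groeneveld-Penrose alternating signs), LavisBell1999 s7.5, OitmaaHamerZheng2006 s2.3, SykesEtAl1972, ButeraComi2002, Fisher1966 J.Chem.Phys.44:616 (SAW end-point shape), deGennes1972 (n->0), Ott2019, PetersRegts2019, card absolute-monotonicity-in-temperature (triage-14: new-combination))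

History (route lifecycle, newest last):
- 2026-08-15T16:23:34Z · rev 3: restated PlanarPressureAM (stmt-CriticalPhenomena-8363) — route-repair (cone guardrail, unit rrepair-CriticalPhenomena-BernsteinTem-34feefdb-g2): (a) REROUTED — imports: [] drops `import Literature.Probability.LatticeM (planner-rrepair-CriticalPhenomena-BernsteinTem-34feefdb-g2-0)
- 2026-08-24T20:49:26Z · DORMANT — reconciler: no traction for 7.1 d (last activity item-evidence-added at 2026-08-17T18:45:47Z); parked, not closed — `ledger route dormant route-CriticalPhenomen (operator:999:2128741)

sub-problem: Ising3DConformalLimit · status: dormant · opened planner-plancard-CriticalPhenomena-Ising3DCon-0fce8fa1-0 2026-08-15T12:41:53Z · rev 4 · ledger route-CriticalPhenomena-BernsteinTemperature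
GENERATED by the gate from the ledger (D-0016/17). Provers cite these decls: `theorem foo : Summit.CriticalPhenomena.Ising3DConformalLimit.Theses.BernsteinTemperature.<Decl> := …` in Summits/CriticalPhenomena/Ising3DConformalLimit/Theorems/<Name>.lean.
-/

namespace Summit.CriticalPhenomena.Ising3DConformalLimit.Theses.BernsteinTemperature

open scoped BigOperators Topology Manifold Classical MeasureTheory ProbabilityTheory Matrix InnerProductSpace ComplexConjugate ContinuousMap
open Filter Set Function TopologicalSpace MeasureTheory

attribute [summit_statement] _root_.Ising3DConformalLimit

/-- item stmt-CriticalPhenomena-8357 · crux · rank 2 · open · by planner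
why it might fail: All-order positivity of the tanh-coefficients a_n(x) is verified only exactly to n ≤ 15 (|x|₁ ≤ 4; χ to ~25): a signed linked-cluster vacuum correction could make some a_n(x) < 0 in the window n − |x|₁ ≳ 15, or an infinite-volume complex singularity of some G_x could lie inside |v| < v_c = 0.21809.
sources: FisherBurford1967, Guttmann1987, ButeraComi2002, OitmaaHamerZheng2006, doi:10.1103/physrevb.6.3426 (Ferer–Wortis 1972, sc/bcc/fcc correlation series), Penrose1963
[crux] (AM-v)₃, card item N1, robust form: for every x ∈ ℤ³ there are coefficients a_n ≥ 0,
vanishing for n < |x|₁ and for n ≢ |x|₁ (mod 2), with ⟨σ₀σ_x⟩⁺_β = Σ_n a_n tanhⁿβ (convergent) for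
all 0 ≤ β < β_c(3). Equivalently tanh β ↦ ⟨σ₀σ_x⟩ is absolutely monotone on [0, v_c): all HT
coefficients are ≥ 0 AND no complex singularity of the infinite-volume correlation lies in |v| <
v_c. k = 1 is GKS; true on trees/ℤ (⟨σ₀σ_x⟩ = v^{|x|}); finite-volume correlations are never AM to
all orders (Fisher-zero pairs), so this is a thermodynamic-limit statement. [difficulty:
open-problem] -/
@[route_item "route-CriticalPhenomena-BernsteinTemperature", crux]
def AbsMonotoneTanh : Prop :=
  ∀ x : Literature.Probability.LatticeModels.Site 3, ∃ a : ℕ → ℝ, (∀ n, 0 ≤ a n) ∧ (∀ n, (n < ∑ i, (x i).natAbs ∨ ¬ Even (n + ∑ i, (x i).natAbs)) → a n = 0) ∧ ∀ β : ℝ, 0 ≤ β → β < Literature.Probability.LatticeModels.criticalBeta 3 → HasSum (fun n => a n * Real.tanh β ^ n) (Literature.Probability.LatticeModels.twoPointPlus 3 β x)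

/-- item stmt-CriticalPhenomena-8358 · crux · rank 3 · open · by planner
why it might fail: Four open claims, ONE shared ν: pure-power s_n ~ C n^{γ−1} (existence of γ on ℤ³ open), polynomial tails, RADIAL local limit of fixed-order HT kernels; lattice anisotropy of the critical 2-pt function vanishes only conjecturally (ρ≈2); an extra singularity of G_x on |v|=v_c kills regular variation.
sources: CampostriniEtAl1998, CampostriniEtAl1997, doi:10.1103/physrevlett.22.940 (Moore–Jasnow–Wortis 1969), FisherBurford1967, ButeraComi2002, Fisher1967
[crux] card item N3 made precise: for every non-negative coefficient family a : ℤ³ × ℕ → ℝ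
representing the two-point functions as in AbsMonotoneTanh, there are ν > 0, γ < 3ν, C, A > 0, p > 3
− γ/ν and a continuous profile Q ≥ 0 on [0,∞), positive somewhere, with: Σ_y a_n(y) < ∞; regular
variation with a pure power of the susceptibility coefficients, tanhⁿβ_c · Σ_y a_n(y) / n^{γ−1} → C;
the isotropic local limit sup_{|x|₂ ≤ R n^ν, n ≡ |x|₁ (2)} |n^{3ν} a_n(x)/(2Σ_y a_n(y)) −
Q(|x|₂/n^ν)| → 0 for every R; and the tail bound n^{3ν} a_n(x)/Σ_y a_n(y) ≤ A (1 + |x|₂/n^ν)^{−p}.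
(Scaling theory: Q(r) ~ r^{(γ−1)/ν} at 0, stretched-exponential tails; Q radial = isotropy of the
near-critical scaling function organised by expansion order.) [deps: AbsMonotoneTanh] [difficulty:
open-problem] -/
@[route_item "route-CriticalPhenomena-BernsteinTemperature", crux]
def KernelLocalLimit : Prop :=
  ∀ a : Literature.Probability.LatticeModels.Site 3 → ℕ → ℝ, (∀ x n, 0 ≤ a x n) → (∀ x n, (n < ∑ i, (x i).natAbs ∨ ¬ Even (n + ∑ i, (x i).natAbs)) → a x n = 0) → (∀ (x : Literature.Probability.LatticeModels.Site 3) (β : ℝ), 0 ≤ β → β < Literature.Probability.LatticeModels.criticalBeta 3 → HasSum (fun n => a x n * Real.tanh β ^ n) (Literature.Probability.LatticeModels.twoPointPlus 3 β x)) → ∃ (ν γ C A p : ℝ) (Q : ℝ → ℝ), 0 < ν ∧ γ < 3 * ν ∧ 0 < C ∧ 0 < A ∧ 3 - γ / ν < p ∧ ContinuousOn Q (Set.Ici 0) ∧ (∀ r, 0 ≤ r → 0 ≤ Q r) ∧ (∃ r, 0 ≤ r ∧ 0 < Q r) ∧ (∀ n, Summable (fun y : Literature.Probability.LatticeModels.Site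 3 => a y n)) ∧ Filter.Tendsto (fun n : ℕ => Real.tanh (Literature.Probability.LatticeModels.criticalBeta 3) ^ n * (∑' y : Literature.Probability.LatticeModels.Site 3, a y n) / (n : ℝ) ^ (γ - 1)) Filter.atTop (nhds C) ∧ (∀ R ε : ℝ, 0 < R → 0 < ε → ∀ᶠ n : ℕ in Filter.atTop, ∀ x : Literature.Probability.LatticeModels.Site 3, Real.sqrt (∑ i, ((x i : ℝ)) ^ 2) ≤ R * (n : ℝ) ^ ν → Even (n + ∑ i, (x i).natAbs) → |(n : ℝ) ^ (3 * ν) * a x n / (2 * ∑' y : Literature.Probability.LatticeModels.Site 3, a y n) - Q (Real.sqrt (∑ i, ((x i : ℝ)) ^ 2) / (n : ℝ) ^ ν)| ≤ ε) ∧ (∀ (x : Literature.Probability.LatticeModels.Site 3) (n : ℕ), 1 ≤ n → (n : ℝ) ^ (3 * ν) * a x n / (∑' y : Literature.Probability.LatticeModels.Site 3, a y n) ≤ A * (1 + Real.sqrt (∑ i, ((x i : ℝ)) ^ 2) / (n : ℝ) ^ ν) ^ (-p))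

/-- item stmt-CriticalPhenomena-8359 · crux · rank 4 · open · by planner
why it might fail: Infinitesimally the LOWER bound d/dβ log⟨σ₀σ_x⟩_β ≥ 2|x|₁/sinh 2β (sharp on trees) for β < β_c, plus the β_c endpoint; only GKS (≥ 0) and UPPER bounds on β-derivatives (Lebowitz/GHS, Graham 1982, Simon–Lieb) are proved; thinnest margin ×1.2–1.5 on diagonals x = (k,k,k), β ≈ 0.05–0.15; no MC yet.
sources: doi:10.1007/bf01020780 (Graham 1982, JSP: inequalities for β-derivatives of the truncated two-point function), Lebowitz1974, Simon1980CMP, MessagerMiracleSoleJSP1977, AizenmanBarskyFernandez1987, DuminilCopinTassionCMP2016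
[crux] card consequence (C1), the teeth, filed as its own refutable statement (weaker than
AbsMonotoneTanh, implied by it via MassFromAM): for all x ∈ ℤ³ and 0 ≤ β ≤ β' ≤ β_c(3), ⟨σ₀σ_x⟩⁺_β ·
tanh^{|x|₁}β' ≤ ⟨σ₀σ_x⟩⁺_{β'} · tanh^{|x|₁}β, i.e. β ↦ ⟨σ₀σ_x⟩_β / tanh^{|x|₁}β is non-decreasing up
to AND including β_c (saturated on trees). At β' = β_c: ⟨σ₀σ_x⟩_β ≤ (tanh β/tanh
β_c)^{|x|₁}⟨σ₀σ_x⟩_{β_c} — sharpness with the explicit mass m(β) ≥ log(tanh β_c/tanh β) ≥ c(β_c −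
β), hence ν ≤ 1 (NuLeOne); no rigorous upper bound on ν(3) was found in the searched literature.
[difficulty: L] -/
@[route_item "route-CriticalPhenomena-BernsteinTemperature", crux]
def ThreeTemperature : Prop :=
  ∀ (x : Literature.Probability.LatticeModels.Site 3) (β β' : ℝ), 0 ≤ β → β ≤ β' → β' ≤ Literature.Probability.LatticeModels.criticalBeta 3 → Literature.Probability.LatticeModels.twoPointPlus 3 β x * Real.tanh β' ^ (∑ i, (x i).natAbs) ≤ Literature.Probability.LatticeModels.twoPointPlus 3 β' x * Real.tanh β ^ (∑ i, (x i).natAbs)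

/-- item stmt-CriticalPhenomena-4801 · crux · rank 5 · open · by planner
why it might fail: Given the two-point pure power law, existence of the δ→0⁺ limits for n ≥ 4, O(3) invariance of S_n and inversion covariance all stay open on ℤ³ (ICM 2022 §8.4); Euclid + scale ⇏ Möbius in general (ScaleCovarianceNotMoebius) and no planar engine transposes to d = 3 (LiouvilleRigidity).
sources: DuminilCopinICM2022, PolandRychkovVichi2019, Literature.Barriers.CriticalPhenomena.ScaleCovarianceNotMoebius, Literature.Barriers.CriticalPhenomena.LiouvilleRigidity, stmt-CriticalPhenomena-0634, stmt-CriticalPhenomena-1344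
[crux] (IMPORTED COMPLEMENT, where the two-point spine is load-bearing) if the critical two-point
function on ℤ³ is asymptotically an isotropic pure power law, ⟨σ₀σ_x⟩_{β_c}·|x|₂^(2Δ) → c > 0 (item
0634 IsingEuclidUpgradeR2RotInvPowerLaw, verbatim as hypothesis), then the critical correlators have
a non-degenerate pointwise scaling limit (ρ > 0 on (0,1], Δ' > 0, S) that is Möbius covariant (item
1344 PerfectScreening.MoebiusLimitExists, verbatim as conclusion: the conjunct minus clause (iii)).
The two-point law supplies ρ(δ) = δ^(−Δ), non-degeneracy and Möbius covariance of S₂ outright; what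
remains is existence/uniqueness of the n ≥ 4 limits and their O(3)/inversion covariance — not
attacked here (bets: IsingEuclidUpgrade 0637/0638, HyperoctahedralRP 1980–1982, IsingCFTData 0665,
cards inversion-first-moebius-from-translations, rotations-are-boosts-modular). Existential
conclusion: no coincident-configuration junk (take S = 0 off NonCoincident). [difficulty:
open-problem] -/
@[route_item "route-CriticalPhenomena-BernsteinTemperature", crux]
def MoebiusLimitOfTwoPointLaw : Prop :=
  (∃ Δ c : ℝ, 0 < c ∧ Filter.Tendsto (fun x : Literature.Probability.LatticeModels.Site 3 => Literature.Probability.LatticeModels.criticalTwoPoint 3 x * Real.sqrt (∑ i, ((x i : ℝ)) ^ 2) ^ (2 * Δ)) Filter.cofinite (nhds c)) → (∃ (ρ : ℝ → ℝ) (Δ : ℝ) (S : Literature.Probability.LatticeModels.CorrFamily 3), (∀ δ ∈ Set.Ioc (0:ℝ) 1, 0 < ρ δ) ∧ 0 < Δ ∧ Literature.Probability.LatticeModels.HasPointwiseScalingLimit (Literature.Probability.LatticeModels.criticalCorr 3) ρ S ∧ Literature.Probability.LatticeModels.IsNondegenerateTwoPoint S ∧ Literature.Probability.LatticeModels.IsMoebiusCovariant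 Δ S)

/-- item stmt-CriticalPhenomena-0636 · crux · rank 6 · open · by planner
why it might fail: No proof that U₄ ≢ 0 in d = 3: via U₄ = −2⟨σσ⟩⟨σσ⟩·P[two double-current clusters meet] the intersection probability must stay > 0 at macroscopic separation as δ → 0; for d ≥ 4 (ADC 2021) and for RP long-range models on ℤ³ with α < 3/2 (Panis 2023) every such limit IS Gaussian.
sources: AizenmanDuminilCopinAnnals2021, AizenmanCMP1982, Panis2023Triviality, DuminilCopinICM2022, Literature.Probability.LatticeModels.ursellFour_eq_doubleCurrent, Literature.Probability.LatticeModels.highDim_triviality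
Crux r4 (non-triviality in d=3): every non-degenerate pointwise scaling limit S of the renormalised
critical Ising correlators on Z^3 has connected four-point function U4 ≢ 0 on non-coincident
configurations. Intended tool: the random-current identity U4(x,y,z,t) =
−2⟨σxσy⟩⟨σzσt⟩·P^{xy,zt}[C_{n1+n2}(x) ∩ C_{n1+n2}(z) ≠ ∅] (Aizenman 1982; ADC2021 arXiv:1912.07973
eq. (3.11)): non-Gaussianity ⇔ the intersection probability of the two double-current clusters at
macroscopic separation does not vanish as δ → 0. Contrast: for d ≥ 4 every such limit IS Gaussian
(Literature.Probability.LatticeModels.highDim_triviality). Its negation refutes the conjunct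
Ising3DConformalLimit itself. -/
@[route_item "route-CriticalPhenomena-BernsteinTemperature", crux]
def IsingEuclidUpgradeR4NonGaussian : Prop :=
  ∀ (ρ : ℝ → ℝ) (S : Literature.Probability.LatticeModels.CorrFamily 3), (∀ δ ∈ Set.Ioc (0:ℝ) 1, 0 < ρ δ) → Literature.Probability.LatticeModels.HasPointwiseScalingLimit (Literature.Probability.LatticeModels.criticalCorr 3) ρ S → Literature.Probability.LatticeModels.IsNondegenerateTwoPoint S → Literature.Probability.LatticeModels.HasNontrivialU4 S

/-- item stmt-CriticalPhenomena-0634 · support · rank 9 · open · by planner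
sources: DuminilCopinICM2022, stmt-CriticalPhenomena-0634, Literature.Probability.LatticeModels.criticalTwoPoint_bounds_holds
Crux r2 (hardest, most informative): the critical two-point function of the n.n. Ising model on Z^3
is asymptotically a rotation-invariant pure power law: there are Δ and c>0 with ⟨σ_0 σ_x⟩_{β_c(3)} ·
|x|_2^{2Δ} → c as |x| → ∞ (Euclidean norm, cofinite filter on Z^3). Gives existence of η = 2Δ−1,
forces ρ(δ) ≍ δ^{-Δ}, and is rotation invariance at the two-point level (open on Z^3: Duminil-Copin
ICM2022 arXiv:2208.00864 §8; 2-D analogue for FK models: DKKMO arXiv:2012.11672). Known input: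
c|x|^{-2} ≤ ⟨σ0σx⟩ ≤ C|x|^{-1} (Literature.Probability.LatticeModels.criticalTwoPoint_bounds), so Δ
∈ [1/2,1] if it exists. -/
@[route_item "route-CriticalPhenomena-BernsteinTemperature", crux]
def IsingEuclidUpgradeR2RotInvPowerLaw : Prop :=
  ∃ Δ c : ℝ, 0 < c ∧ Filter.Tendsto (fun x : Literature.Probability.LatticeModels.Site 3 => Literature.Probability.LatticeModels.criticalTwoPoint 3 x * Real.sqrt (∑ i, ((x i : ℝ)) ^ 2) ^ (2 * Δ)) Filter.cofinite (nhds c)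

-- earlier PlanarPressureAM (stmt-CriticalPhenomena-8363, replaced 2026-08-15T16:23:34Z -> stmt-CriticalPhenomena-10768): retired by None — ∃ a : ℕ → ℝ, (∀ n, 0 ≤ a n) ∧ ∀ β : ℝ, 0 ≤ β → β < Literature.Probability.LatticeModels.criticalBetaTwo → HasSum (fun n => a n * Real.tanh β ^ n) (Literature.Probability.LatticeModels.onsagerPressure β)
/-- item stmt-CriticalPhenomena-10768 · support · rank 9 · closed · proved by Summit.CriticalPhenomena.Ising3DConformalLimit.Theorems.planarPressureAM_proof @ 872c750c0c65 (prover) · by planner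
sources: Onsager1944, MccoyWu1973, YangTian2021, OitmaaHamerZheng2006, LavisBell1999
[support] the solvable rung (card N4, pressure form), RESTATED OVER MATHLIB ONLY (route-repair, cone
guardrail): Onsager's closed-form square-lattice pressure ψ(β) = log 2 + (8π²)⁻¹∫₀^{2π}∫₀^{2π}
log(cosh²2β − sinh 2β (cos θ₁ + cos θ₂)) dθ₁dθ₂ is absolutely monotone in v = tanh β on [0, β_c(2)):
∃ a_n ≥ 0 with ψ(β) = Σ a_n tanhⁿβ (convergent) for 0 ≤ β < log(1+√2)/2. The Literature constants
`onsagerPressure` / `criticalBetaTwo`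
(Literature/Probability/LatticeModels/PlanarIsing.lean:188/:166) are unfolded VERBATIM so the route
file no longer imports PlanarIsing (whose four unproved CHI facts rode into the cone unused); the
restatement is rfl-defeq to the rev-2 item (planner Sketch.lean `restate_defeq`), so a prover may
`show ∃ a, … (onsagerPressure β)` by `rfl`-rewriting and use pressure_two_eq_onsagerPressure /
criticalBeta_two freely in the Theorems file. Evidence: ψ = log 2 − log(1 − v²) + (v⁴ + 2v⁶ + 9/2 v⁸
+ 12v¹⁰ + …) with all known polygon coefficients positive; the triage refuter's exact check of the
n.n. energy u(v) to order 127 (all coefficients > 0) gives positivity of ψ's v-coefficients to order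
128 (ψ' = 2u/(1−v²)); Darboux at the two singularities ±v_c ((1∓v/v_c)² log -/
@[route_item "route-CriticalPhenomena-BernsteinTemperature", crux]
def PlanarPressureAM : Prop :=
  ∃ a : ℕ → ℝ, (∀ n, 0 ≤ a n) ∧ ∀ β : ℝ, 0 ≤ β → β < Real.log (1 + Real.sqrt 2) / 2 → HasSum (fun n => a n * Real.tanh β ^ n) (Real.log 2 + (1 / (8 * Real.pi ^ 2)) * ∫ θ₁ in (0 : ℝ)..2 * Real.pi, ∫ θ₂ in (0 : ℝ)..2 * Real.pi, Real.log (Real.cosh (2 * β) ^ 2 - Real.sinh (2 * β) * (Real.cos θ₁ + Real.cos θ₂)))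

/-- item stmt-CriticalPhenomena-8360 · support · rank 9 · closed · proved by Summit.CriticalPhenomena.Ising3DConformalLimit.Theorems.kernelTransfer_proof @ 5b0bf56cac1b (prover) · by planner
sources: Fisher1967, FriedliVelenik2017, Literature.Probability.LatticeModels.twoPointPlus_criticalBeta_eq_twoPointFree_holds, Literature.Probability.LatticeModels.plusCorr_mono_params
[support] glue (Abelian summation, real analysis; card (C5)): AbsMonotoneTanh → KernelLocalLimit →
IsingEuclidUpgradeR2RotInvPowerLaw. Proof sketch: from (AM), monotone convergence and the tree facts
plusCorr_mono_params, left-continuity of the free state in β (sup of box limits),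
twoPointFree_le_twoPointPlus_holds and twoPointPlus_criticalBeta_eq_twoPointFree_holds,
⟨σ₀σ_x⟩_{β_c} = Σ_n a_n(x) v_cⁿ = Σ_n s_n q_n(x) (finite, ≤ 1); parity halves the n-sum against the
factor 2; the local limit with the integrable majorant A s_n n^{−3ν}(1+|x|/n^ν)^{−p} (p > 3 − γ/ν, γ
< 3ν) turns Σ_n into C|x|^{−(3−γ/ν)} ∫₀^∞ u^{γ−1−3ν} Q(u^{−ν}) du · (1+o(1)) by dominated
convergence after n = |x|^{1/ν}u; so 2Δ = 3 − γ/ν and c > 0. [difficulty: M] -/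
@[route_item "route-CriticalPhenomena-BernsteinTemperature", crux]
def KernelTransfer : Prop :=
  AbsMonotoneTanh → KernelLocalLimit → IsingEuclidUpgradeR2RotInvPowerLaw

/-- item stmt-CriticalPhenomena-8361 · support · rank 9 · closed · proved by Summit.CriticalPhenomena.Ising3DConformalLimit.BernsteinTemperatureMassFromAM.massFromAM_proof @ 657f3200cf4f (prover) · by planner
sources: FriedliVelenik2017, Literature.Probability.LatticeModels.plusCorr_mono_params, Literature.Probability.LatticeModels.twoPointPlus_zero
[support] glue, provable now (card N2 = (AM) ⇒ (C1)): AbsMonotoneTanh → ThreeTemperature. For β ≤ β'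
< β_c: ⟨σ₀σ_x⟩_β = v^L Σ_{n≥L} a_n v^{n−L} with L = |x|₁ and the second factor non-decreasing in v =
tanh β; for β' = β_c use ⟨σ₀σ_x⟩_{β''} ≤ ⟨σ₀σ_x⟩⁺_{β_c} (plusCorr_mono_params) for β'' < β_c and let
β'' ↑ β_c in tanh (continuity); x = 0 and β = 0 are trivial (twoPointPlus_zero, 0^L). [difficulty:
provable-now] -/
@[route_item "route-CriticalPhenomena-BernsteinTemperature", crux]
def MassFromAM : Prop :=
  AbsMonotoneTanh → ThreeTemperature

/-- item stmt-CriticalPhenomena-8362 · support · rank 9 · closed · proved by Summit.CriticalPhenomena.Ising3DConformalLimit.Theorems.nuLeOne_proof (prover) · by planner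
sources: Fisher1967, FriedliVelenik2017, Literature.Probability.LatticeModels.twoPointPlus_mul_le_twoPointPlus, Literature.Probability.LatticeModels.twoPointPlus_le_one_of_nonneg
[support] provable now (card (C1) ⇒ ν ≤ 1): ThreeTemperature → every correlation-length exponent ν
of the ℤ³ Ising model (HasIsingExponentNu 3 ν: log ξ(β)/log(β_c − β) → −ν, ξ = axis correlation
length of the plus state) satisfies ν ≤ 1. Proof: ThreeTemperature at β' = β_c, x = n e₁ and ⟨σσ⟩ ≤
1 give ⟨σ₀σ_{ne₁}⟩⁺_β ≤ (tanh β/tanh β_c)ⁿ, while ⟨σ₀σ_{ne₁}⟩⁺_β ≥ ⟨σ₀σ_{e₁}⟩ⁿ > 0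
(twoPointPlus_mul_le_twoPointPlus); so invCorrLength ≥ log(tanh β_c/tanh β) ≥ c(β_c − β) and ξ(β) ≤
C/(β_c − β) near β_c; divide logs (log(β_c − β) < 0). [difficulty: provable-now] -/
@[route_item "route-CriticalPhenomena-BernsteinTemperature", crux]
def NuLeOne : Prop :=
  ThreeTemperature → ∀ ν : ℝ, Literature.Probability.LatticeModels.HasIsingExponentNu 3 ν → ν ≤ 1

/-- item stmt-CriticalPhenomena-8364 · assembly · rank 1 · closed · proved by Summit.CriticalPhenomena.Ising3DConformalLimit.Theorems.bernsteinTemperature_assembly_proof @ 0a8001820c7f (prover) · by planner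
sources: DuminilCopinICM2022, Fisher1967
[assembly] AbsMonotoneTanh → KernelLocalLimit → KernelTransfer → MoebiusLimitOfTwoPointLaw →
IsingEuclidUpgradeR4NonGaussian → Ising3DConformalLimit. -/
@[route_item "route-CriticalPhenomena-BernsteinTemperature", crux]
def Assembly : Prop :=
  AbsMonotoneTanh → KernelLocalLimit → KernelTransfer → MoebiusLimitOfTwoPointLaw → IsingEuclidUpgradeR4NonGaussian → Ising3DConformalLimit

/-! D-0027 §2.1 — DECIDING THEOREM (planner-authored via `route open/edit --closes-file`; by operator:999:875655 2026-08-15T14:43:59Z):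
its hypotheses are this route's items and its conclusion the sub-problem Statement (glue_lint), and it elaborates with this file. -/

@[closes "route-CriticalPhenomena-BernsteinTemperature"] theorem closes : AbsMonotoneTanh → KernelLocalLimit → ThreeTemperature → MoebiusLimitOfTwoPointLaw → IsingEuclidUpgradeR4NonGaussian → IsingEuclidUpgradeR2RotInvPowerLaw → KernelTransfer → MassFromAM → NuLeOne → PlanarPressureAM → Assembly → _root_.Ising3DConformalLimit := fun h_AbsMonotoneTanh h_KernelLocalLimit h_ThreeTemperature h_MoebiusLimitOfTwoPointLaw h_IsingEuclidUpgradeR4NonGaussian h_IsingEuclidUpgradeR2RotInvPowerLaw h_KernelTransfer h_MassFromAM h_NuLeOne h_PlanarPressureAM h_Assembly => h_Assembly h_AbsMonotoneTanh h_KernelLocalLimit h_KernelTransfer h_MoebiusLimitOfTwoPointLaw h_IsingEuclidUpgradeR4NonGaussian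

end Summit.CriticalPhenomena.Ising3DConformalLimit.Theses.BernsteinTemperature
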